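import Mathlib
import Summits.ValiantsHypothesis.ValiantsHypothesis.Theorems.NewtonUnitEquationsDissociatedFixedKExposedWord

/-!
# Crux `NewtonUnitEquations.DissociatedUniform` (stmt-ValiantsHypothesis-5905), line
`greedy-basis-shadow` — stub `stub_coeffFormula` (stub B2, the dissociated coefficient formula)

Setting: `k` products of `m` bivariate polynomials `f i j : MvPolynomial (Fin 2) ℂ` on a DISSOCIATED
frame, i.e. `supp (f i j) ⊆ A j` and the sum map `a ↦ ∑ j, a j` is injective on the word box
`Π_j A j = Fintype.piFinset A`.

The dictionary of the sibling crux `DissociatedFixedK` (file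
`NewtonUnitEquationsDissociatedFixedKExposedWord.lean`, namespace
`Summit.ValiantsHypothesis.Theorems.DissociatedFixedK`) is reused, not re-derived:

* `coeff_sum_prod_of_dissociated`:
  `coeff (∑ j, a j) (∑ i, ∏ j, f i j) = ∑ i, ∏ j, coeff (a j) (f i j)` for every word `a` with
  `∀ j, a j ∈ A j` (dissociation makes the monomials of distinct words distinct);
* `exists_word_of_mem_support`: every support exponent of `∑ i, ∏ j, f i j` is `∑ j, a j` for a
  word `a` of the box (with nonzero column sum).

`stub_coeffFormula` (the registered stub) is the conjunction of (1) the dictionary for all words of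
`Fintype.piFinset A` and (2) the support inclusion, i.e. these two facts transported along
`Fintype.mem_piFinset`.  Degenerate cases (`m = 0`, `k = 0`) need no special treatment.
-/

open scoped BigOperators
open MvPolynomial
open Summit.ValiantsHypothesis.Theorems.DissociatedFixedK (coeff_sum_prod_of_dissociated
  exists_word_of_mem_support)

-- Sub = Summit single-conjunct layout: the duplicated namespace component is mandated by the tree.
set_option linter.dupNamespace false

namespace Summit.ValiantsHypothesis.ValiantsHypothesis.Theorems.NewtonUnitEquationsDissociatedUniform

/-- **Stub B2 (`CoeffFormula`) of crux `NewtonUnitEquations.DissociatedUniform`, line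
`greedy-basis-shadow`.**  On a dissociated frame (`supp (f i j) ⊆ A j`, the sum map injective on
the word box `Fintype.piFinset A`):
(1) `coeff (∑ j, a j) (∑ i, ∏ j, f i j) = ∑ i, ∏ j, coeff (a j) (f i j)` for every word `a` of the
box; (2) every exponent of `supp (∑ i, ∏ j, f i j)` is `∑ j, a j` for some word `a` of the box.
[folklore] -/
theorem stub_coeffFormula (k m : ℕ) (A : Fin m → Finset (Fin 2 →₀ ℕ))
    (f : Fin k → Fin m → MvPolynomial (Fin 2) ℂ)
    (hsupp : ∀ i j, (f i j).support ⊆ A j)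
    (hdis : ∀ a b : Fin m → (Fin 2 →₀ ℕ), (∀ j, a j ∈ A j) → (∀ j, b j ∈ A j) → ∑ j, a j = ∑ j, b j → a = b) :
    (∀ a ∈ Fintype.piFinset A, (∑ i, ∏ j, f i j).coeff (∑ j, a j) = ∑ i, ∏ j, (f i j).coeff (a j)) ∧
    ∀ e ∈ (∑ i, ∏ j, f i j).support, ∃ a ∈ Fintype.piFinset A, ∑ j, a j = e := by
  refine ⟨fun a ha => ?_, fun e he => ?_⟩
  · exact coeff_sum_prod_of_dissociated A f hsupp hdis a (Fintype.mem_piFinset.mp ha)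
  · obtain ⟨a, ha, hae, -⟩ := exists_word_of_mem_support A f hsupp hdis he
    exact ⟨a, Fintype.mem_piFinset.mpr ha, hae⟩

end Summit.ValiantsHypothesis.ValiantsHypothesis.Theorems.NewtonUnitEquationsDissociatedUniform
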